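import Mathlib

/-!
# Rank-1 lattice rules: character sums, the dual-lattice error formula, random shifts and the
# shift variance

Let `𝕋ᵈ = (ℝ/ℤ)ᵈ` (`UnitAddTorus d`, Haar probability measure) and, for `n ≥ 1` and a generating
vector `z ∈ ℤᵈ`, let `x_i = (i z / n) mod 1`, `i ∈ ℤ/nℤ`, be the nodes of the `n`-point **rank-1
lattice rule** `Q_{n,z}(f) = (1/n) Σ_i f(x_i)`.  Its **dual lattice** is
`L⊥ = {h ∈ ℤᵈ : h · z ≡ 0 (mod n)}`.  Writing `e_h(x) = e^{2πi h·x}` (`UnitAddTorus.mFourier h`) and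
`f̂(h)` for the Fourier coefficients (`UnitAddTorus.mFourierCoeff`), we formalise:

* the **character property** of lattice point sets (Niederreiter 1992, §5.1, the step before
  (5.4); Lemieux 2009, Lemma 5.17, who attributes it to Sloan–Kachoyan 1987, Thm. 1):
  `Σ_{i ∈ ℤ/nℤ} e_h(x_i) = n` if `h ∈ L⊥` and `= 0` otherwise (`sum_mFourier_latticeNode`);
  equivalently `Q_{n,z}(e_h) = 𝟙_{L⊥}(h)` (`latticeRule_mFourier`).  The proof is orthogonality of
  the standard additive character of `ℤ/nℤ` (Mathlib's `AddChar.sum_mulShift`,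
  `ZMod.isPrimitive_stdAddChar`);
* the **aliasing / error formula** [cite: Niederreiter1992, eq. (5.4)] (Lemieux 2009, eq. (5.34),
  attributed there to Sloan–Kachoyan 1987): if `f ∈ C(𝕋ᵈ)` has absolutely summable Fourier
  coefficients then `Q_{n,z}(f) = Σ_{h ∈ L⊥} f̂(h)`, hence `Q_{n,z}(f) - ∫ f = Σ_{0 ≠ h ∈ L⊥} f̂(h)`
  (`hasSum_latticeRule`, `hasSum_latticeRule_sub_integral`, `latticeRule_sub_integral_eq_tsum`),
  with the comparison bound `‖Q_{n,z}(f) - ∫ f‖ ≤ B` whenever `‖f̂(h)‖ ≤ b(h)` on `L⊥ ∖ {0}` and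
  `Σ_{0 ≠ h ∈ L⊥} b(h) = B` (`norm_latticeRule_sub_integral_le_of_le`; with `b = C · r(h)^{-α}`
  this is the `P_α` bound [cite: Niederreiter1992, Thm. 5.3]);
* more generally, for ANY finite node family `P`, the equal-weight rule `Q_P` applied to such an
  `f` equals `Σ_h f̂(h) · Q_P(e_h)` (`hasSum_qmcAverage`, the summation-interchange step of
  Niederreiter's derivation) — the multivariate form of the aliasing argument behind
  `Literature.Analysis.Quadrature.TrapezoidalRulePeriodic` (the case `d = 1`, `z = 1`);
* the **random shift** ("Cranley–Patterson rotation", Lemieux 2009, §6.2.1 and Prop. 6.1, citing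
  Cranley–Patterson 1976): for every nonempty finite node family `P` and every integrable `f`, the
  shifted rule `Δ ↦ Q_{P+Δ}(f)` has mean `∫ f` over a uniformly distributed shift `Δ ∈ 𝕋ᵈ`
  (`integral_qmcAverage_add_eq`, `integral_latticeRule_add_eq`);
* the **shift variance** [cite: Lemieux2009, Prop. 6.2] (eq. (6.4), attributed there to
  L'Ecuyer–Lemieux 2000): for square-integrable `f`,
  `∫ ‖Q_{n,z}(f(· + Δ)) - ∫ f‖² dΔ = Σ_{0 ≠ h ∈ L⊥} |f̂(h)|²`
  (`hasSum_integral_norm_sq_latticeRule_sub`, `integral_norm_sq_latticeRule_sub_eq_tsum`).  The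
  proof (private lemmas) computes the Fourier coefficients of the shift map `g(Δ) = Q_{P+Δ}(f)` of
  an arbitrary finite node family, `ĝ(h) = Q_P(e_h) f̂(h)` (translation invariance), and applies
  Parseval on `𝕋ᵈ` (Mathlib's `UnitAddTorus.hasSum_sq_mFourierCoeff`), giving
  `∫ ‖Q_{P+Δ}(f) - ∫ f‖² dΔ = Σ_{h ≠ 0} |Q_P(e_h)|² |f̂(h)|²` before specialising to lattices.  Only
  square-integrability is needed here, in contrast with the absolute summability required by the
  error formula (Lemieux 2009, remark after Prop. 6.3).

Design: nodes are indexed by `ℤ/nℤ` (`ZMod n`, `[NeZero n]`) and built from Mathlib's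
`ZMod.toAddCircle`; `latticeNode_intCast` recovers the coordinates `(k z_j / n) mod 1`.  As in
`Mathlib.Analysis.Fourier.AddCircleMulti`, the measure on `ℝ/ℤ` is normalised to total mass `1` by
the same three local instances, so that `volume` on `𝕋ᵈ` agrees with the one used by
`UnitAddTorus.mFourierCoeff`; users of this file should open it the same way.  Deliberately NOT
here: existence of good generating vectors (Niederreiter 1992, Thms. 5.5–5.10; CBC constructions),
Korobov-class (`E^s_α`) membership criteria, and digital nets.

## References

* H. Niederreiter, *Random Number Generation and Quasi-Monte Carlo Methods*, CBMS-NSF 63, SIAM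
  1992, §5.1: eqs. (5.1)–(5.4) and Theorem 5.3. [cite: Niederreiter1992, §5.1]
* C. Lemieux, *Monte Carlo and Quasi-Monte Carlo Sampling*, Springer 2009: Lemma 5.17, eq. (5.34),
  §6.2.1 with Prop. 6.1, and Prop. 6.2 (eq. (6.4)). [cite: Lemieux2009, Prop. 6.2]
* Primary sources as attributed by the two texts above (not consulted directly for this file):
  I. H. Sloan, P. J. Kachoyan, SIAM J. Numer. Anal. 24 (1987) 116–128 (`SloanKachoyan1987`);
  R. Cranley, T. N. L. Patterson, SIAM J. Numer. Anal. 13 (1976) 904–914 (`CranleyPatterson1976`);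
  P. L'Ecuyer, C. Lemieux, Management Science 46 (2000) 1214–1235 (`LecuyerLemieux2000`).

AI-produced formalisation (H21 engines group, seat eng-quad-1, 2026-08-20); no facts, no axioms
beyond Mathlib's, no `sorry`.
-/

open scoped Real
open MeasureTheory Complex Finset UnitAddTorus

noncomputable section

namespace Literature.Analysis.Quadrature

/-- As in `Mathlib.Analysis.Fourier.AddCircleMulti`: the measure on `ℝ / ℤ` has total mass `1`
(local instance, named to avoid clashes with the identical local instances of other files).
[folklore] -/
local instance latticeRules_measureSpace : MeasureSpace UnitAddCircle := ⟨AddCircle.haarAddCircle⟩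

/-- The measure on `ℝ / ℤ` is a Haar measure. [folklore] -/
local instance latticeRules_isAddHaarMeasure :
    Measure.IsAddHaarMeasure (volume : Measure UnitAddCircle) :=
  inferInstanceAs (Measure.IsAddHaarMeasure AddCircle.haarAddCircle)

/-- The measure on `ℝ / ℤ` is a probability measure. [folklore] -/
local instance latticeRules_isProbabilityMeasure :
    IsProbabilityMeasure (volume : Measure UnitAddCircle) :=
  inferInstanceAs (IsProbabilityMeasure AddCircle.haarAddCircle)

variable {d : Type*} [Fintype d]

/-! ### Equal-weight rules, lattice nodes, the dual lattice -/

/-- The equal-weight (quasi-Monte Carlo) average `Q_P(f) = |ι|⁻¹ Σ_i f(P i)` of `f` over a finite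
family of nodes `P : ι → 𝕋ᵈ`. [folklore] -/
def qmcAverage {ι : Type*} [Fintype ι] {E : Type*} [AddCommMonoid E] [Module ℝ E]
    (P : ι → UnitAddTorus d) (f : UnitAddTorus d → E) : E :=
  (Fintype.card ι : ℝ)⁻¹ • ∑ i, f (P i)

/-- Node `i ∈ ℤ/nℤ` of the `n`-point rank-1 lattice with generating vector `z ∈ ℤᵈ`:
`x_i = (i z / n) mod 1 ∈ (ℝ/ℤ)ᵈ`. [cite: Niederreiter1992, eq. (5.1)] -/
def latticeNode (n : ℕ) [NeZero n] (z : d → ℤ) (i : ZMod n) : UnitAddTorus d :=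
  fun j => ZMod.toAddCircle ((z j : ZMod n) * i)

/-- The `n`-point rank-1 lattice rule `Q_{n,z}(f) = (1/n) Σ_{i ∈ ℤ/nℤ} f(x_i)`.
[cite: Niederreiter1992, eq. (5.3)] -/
def latticeRule (n : ℕ) [NeZero n] (z : d → ℤ) {E : Type*} [AddCommMonoid E] [Module ℝ E]
    (f : UnitAddTorus d → E) : E :=
  qmcAverage (latticeNode n z) f

/-- The dual lattice `L⊥ = {h ∈ ℤᵈ : h · z ≡ 0 (mod n)}` of the rank-1 lattice `(n, z)`, as an
additive subgroup of `ℤᵈ`. [cite: Niederreiter1992, §5.1] -/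
def dualLattice (n : ℕ) (z : d → ℤ) : AddSubgroup (d → ℤ) where
  carrier := {h | (n : ℤ) ∣ ∑ j, h j * z j}
  zero_mem' := by simp
  add_mem' := by
    intro a b ha hb
    simp only [Set.mem_setOf_eq, Pi.add_apply, add_mul, sum_add_distrib] at *
    exact dvd_add ha hb
  neg_mem' := by
    intro a ha
    simp only [Set.mem_setOf_eq, Pi.neg_apply, neg_mul, sum_neg_distrib] at *
    exact (dvd_neg).mpr ha

/-- `h ∈ L⊥ ↔ n ∣ h · z` (the defining congruence `h · z ≡ 0 (mod n)`).
[cite: Niederreiter1992, §5.1] -/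
theorem mem_dualLattice {n : ℕ} {z h : d → ℤ} :
    h ∈ dualLattice n z ↔ (n : ℤ) ∣ ∑ j, h j * z j := Iff.rfl

/-- Membership in the dual lattice is decidable (a divisibility in `ℤ`). [folklore] -/
instance dualLattice.decidableMem (n : ℕ) (z : d → ℤ) : DecidablePred (· ∈ dualLattice n z) :=
  fun _ => decidable_of_iff _ mem_dualLattice.symm

/-- `h ∈ L⊥ ↔ h · z = 0` in `ℤ/nℤ`. [cite: Niederreiter1992, §5.1] -/
theorem mem_dualLattice_iff_cast_eq_zero {n : ℕ} {z h : d → ℤ} :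
    h ∈ dualLattice n z ↔ (∑ j, (h j : ZMod n) * (z j : ZMod n)) = 0 := by
  rw [mem_dualLattice, ← ZMod.intCast_zmod_eq_zero_iff_dvd]
  push_cast
  rfl

omit [Fintype d] in
/-- Coordinates of the lattice nodes: for an integer representative `k` of `i`,
`(x_i)_j = (k z_j / n) mod 1`. [cite: Niederreiter1992, eq. (5.1)] -/
theorem latticeNode_intCast (n : ℕ) [NeZero n] (z : d → ℤ) (k : ℤ) (j : d) :
    latticeNode n z (k : ZMod n) j = ((((k * z j : ℤ) : ℝ) / n : ℝ) : UnitAddCircle) := by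
  simp only [latticeNode]
  rw [show ((z j : ZMod n) * (k : ZMod n)) = ((k * z j : ℤ) : ZMod n) by push_cast; ring,
    ZMod.toAddCircle_intCast]

/-! ### The character property of lattice point sets -/

/-- An additive character turns finite sums into products. [folklore] -/
private theorem AddChar.map_finset_sum {A M ι : Type*} [AddCommMonoid A] [CommMonoid M]
    (ψ : AddChar A M) (s : Finset ι) (a : ι → A) :
    ψ (∑ i ∈ s, a i) = ∏ i ∈ s, ψ (a i) := by
  classical
  induction s using Finset.induction_on with
  | empty => simp [AddChar.map_zero_eq_one]
  | insert i s hi ih => rw [sum_insert hi, prod_insert hi, AddChar.map_add_eq_mul, ih]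

/-- `fourier m (j/n) = ψ_n(m j)` with `ψ_n` the standard additive character of `ℤ/nℤ`. [folklore] -/
private theorem fourier_toAddCircle {n : ℕ} [NeZero n] (m : ℤ) (y : ZMod n) :
    fourier m (ZMod.toAddCircle y) = ZMod.stdAddChar ((m : ZMod n) * y) := by
  rw [fourier_apply, ← map_zsmul ZMod.toAddCircle m y, zsmul_eq_mul]
  rfl

/-- The character `e_h(x) = e^{2πi h·x}` at the lattice node `x_i` is the standard additive
character of `ℤ/nℤ` at `(h·z) i`. [cite: Niederreiter1992, §5.1] -/
theorem mFourier_latticeNode (n : ℕ) [NeZero n] (z h : d → ℤ) (i : ZMod n) :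
    mFourier h (latticeNode n z i) =
      ZMod.stdAddChar (i * ∑ j, (h j : ZMod n) * (z j : ZMod n)) := by
  simp only [mFourier, latticeNode, ContinuousMap.coe_mk, fourier_toAddCircle]
  rw [mul_sum, AddChar.map_finset_sum]
  refine prod_congr rfl fun j _ => ?_
  congr 1
  ring

/-- **Character property of rank-1 lattice point sets** [cite: Lemieux2009, Lemma 5.17]
(attributed there to Sloan–Kachoyan 1987, Thm. 1; also Niederreiter 1992, §5.1, the step before
eq. (5.4)): `Σ_{i ∈ ℤ/nℤ} e^{2πi h·x_i} = n` if `h ∈ L⊥`, and `= 0` otherwise. -/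
theorem sum_mFourier_latticeNode (n : ℕ) [NeZero n] (z h : d → ℤ) :
    ∑ i : ZMod n, mFourier h (latticeNode n z i) = if h ∈ dualLattice n z then (n : ℂ) else 0 := by
  classical
  simp only [mFourier_latticeNode]
  rw [AddChar.sum_mulShift _ (ZMod.isPrimitive_stdAddChar n), ZMod.card]
  by_cases hh : h ∈ dualLattice n z
  · rw [if_pos (mem_dualLattice_iff_cast_eq_zero.mp hh), if_pos hh]
  · rw [if_neg (fun h0 => hh (mem_dualLattice_iff_cast_eq_zero.mpr h0)), if_neg hh, Nat.cast_zero]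

/-- The lattice rule integrates the character `e_h` exactly to the indicator of the dual lattice:
`Q_{n,z}(e_h) = 1` if `h ∈ L⊥`, else `0` (whereas `∫ e_h = [h = 0]`).
[cite: Lemieux2009, Lemma 5.17] -/
theorem latticeRule_mFourier (n : ℕ) [NeZero n] (z h : d → ℤ) :
    latticeRule n z (mFourier h) = if h ∈ dualLattice n z then (1 : ℂ) else 0 := by
  have hn : (n : ℂ) ≠ 0 := by exact_mod_cast NeZero.ne n
  simp only [latticeRule, qmcAverage, ZMod.card, sum_mFourier_latticeNode, Complex.real_smul]
  split_ifs
  · push_cast; field_simp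
  · simp

/-! ### Aliasing: equal-weight rules applied to absolutely convergent Fourier series -/

/-- **Aliasing formula for equal-weight rules** [cite: Niederreiter1992, §5.1] (the
summation-interchange step in the derivation of eq. (5.4), which is valid for an arbitrary finite
node set): if `f ∈ C(𝕋ᵈ)` has absolutely summable Fourier coefficients, then for every finite node
family `P`, `Q_P(f) = Σ_{h ∈ ℤᵈ} f̂(h) · Q_P(e_h)` (absolutely convergent). -/
theorem hasSum_qmcAverage {ι : Type*} [Fintype ι] (P : ι → UnitAddTorus d)
    {f : C(UnitAddTorus d, ℂ)} (hf : Summable (mFourierCoeff f)) :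
    HasSum (fun h => mFourierCoeff f h * qmcAverage P (mFourier h)) (qmcAverage P f) := by
  have H := (hasSum_sum (s := univ)
    (fun i _ => hasSum_mFourier_series_apply_of_summable hf (P i))).const_smul
    ((Fintype.card ι : ℝ)⁻¹)
  simp only [qmcAverage]
  convert H using 1
  ext h
  simp only [Complex.real_smul, smul_eq_mul, mul_sum]
  exact sum_congr rfl fun i _ => by ring

/-- The integral is the zeroth Fourier coefficient: `f̂(0) = ∫ f` ("the exact value of the integral
is given by `f̂(0)`"). [cite: Niederreiter1992, §5.1] -/
theorem mFourierCoeff_zero {E : Type*} [NormedAddCommGroup E] [NormedSpace ℂ E]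
    (f : UnitAddTorus d → E) : mFourierCoeff f 0 = ∫ x, f x := by
  simp [mFourierCoeff, mFourier_zero]

/-- **Lattice rules see exactly the dual-lattice Fourier coefficients**
[cite: Niederreiter1992, §5.1] (the identity preceding eq. (5.4)): if `f ∈ C(𝕋ᵈ)` has absolutely
summable Fourier coefficients then `Q_{n,z}(f) = Σ_{h ∈ L⊥} f̂(h)`. -/
theorem hasSum_latticeRule (n : ℕ) [NeZero n] (z : d → ℤ) {f : C(UnitAddTorus d, ℂ)}
    (hf : Summable (mFourierCoeff f)) :
    HasSum (fun h : dualLattice n z => mFourierCoeff f h) (latticeRule n z f) := by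
  classical
  have H := hasSum_qmcAverage (latticeNode n z) hf
  have H' : HasSum ((dualLattice n z : Set (d → ℤ)).indicator (mFourierCoeff f))
      (latticeRule n z f) := by
    refine (H.congr_fun fun h => ?_)
    change _ = mFourierCoeff f h * latticeRule n z (mFourier h)
    rw [latticeRule_mFourier, Set.indicator_apply]
    split_ifs with h1 <;> simp_all
  exact (hasSum_subtype_iff_indicator (f := mFourierCoeff f)
    (s := (dualLattice n z : Set (d → ℤ)))).mpr H'

/-- **Error of a lattice rule** [cite: Niederreiter1992, eq. (5.4)] (Lemieux 2009, eq. (5.34)):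
for `f ∈ C(𝕋ᵈ)` with absolutely summable Fourier coefficients,
`Q_{n,z}(f) - ∫_{𝕋ᵈ} f = Σ_{0 ≠ h ∈ L⊥} f̂(h)`. -/
theorem hasSum_latticeRule_sub_integral (n : ℕ) [NeZero n] (z : d → ℤ)
    {f : C(UnitAddTorus d, ℂ)} (hf : Summable (mFourierCoeff f)) :
    HasSum (fun h : ((dualLattice n z : Set (d → ℤ)) \ {0} : Set (d → ℤ)) => mFourierCoeff f h)
      (latticeRule n z f - ∫ x, f x) := by
  classical
  have H0 : HasSum ((dualLattice n z : Set (d → ℤ)).indicator (mFourierCoeff f))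
      (latticeRule n z f) := hasSum_subtype_iff_indicator.mp (hasSum_latticeRule n z hf)
  have H1 := hasSum_ite_sub_hasSum H0 0
  rw [Set.indicator_of_mem (by simp : (0 : d → ℤ) ∈ (dualLattice n z : Set (d → ℤ))),
    mFourierCoeff_zero] at H1
  refine (hasSum_subtype_iff_indicator (f := mFourierCoeff f)
    (s := ((dualLattice n z : Set (d → ℤ)) \ {0} : Set (d → ℤ)))).mpr (H1.congr_fun fun h => ?_)
  by_cases h0 : h = 0
  · subst h0; simp
  · simp only [h0, if_false, Set.indicator_apply, Set.mem_sdiff, Set.mem_singleton_iff,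
      not_false_eq_true, and_true]

/-- The lattice-rule error as a sum over the dual lattice minus the origin (`tsum` form).
[cite: Lemieux2009, eq. (5.34)] -/
theorem latticeRule_sub_integral_eq_tsum (n : ℕ) [NeZero n] (z : d → ℤ)
    {f : C(UnitAddTorus d, ℂ)} (hf : Summable (mFourierCoeff f)) :
    latticeRule n z f - ∫ x, f x =
      ∑' h : ((dualLattice n z : Set (d → ℤ)) \ {0} : Set (d → ℤ)), mFourierCoeff f h :=
  (hasSum_latticeRule_sub_integral n z hf).tsum_eq.symm

/-- `‖Q_{n,z}(f) - ∫ f‖ ≤ Σ_{0 ≠ h ∈ L⊥} ‖f̂(h)‖`. [cite: Niederreiter1992, §5.1] -/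
theorem norm_latticeRule_sub_integral_le (n : ℕ) [NeZero n] (z : d → ℤ)
    {f : C(UnitAddTorus d, ℂ)} (hf : Summable (mFourierCoeff f)) :
    ‖latticeRule n z f - ∫ x, f x‖ ≤
      ∑' h : ((dualLattice n z : Set (d → ℤ)) \ {0} : Set (d → ℤ)), ‖mFourierCoeff f h‖ := by
  rw [latticeRule_sub_integral_eq_tsum n z hf]
  exact norm_tsum_le_tsum_norm (hf.norm.subtype _)

/-- **Comparison form (the `P_α`-type bound)** [cite: Niederreiter1992, Thm. 5.3]: if
`‖f̂(h)‖ ≤ b(h)` for all `0 ≠ h ∈ L⊥` and `Σ_{0 ≠ h ∈ L⊥} b(h) = B`, then `‖Q_{n,z}(f) - ∫ f‖ ≤ B`.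
(With `b(h) = C r(h)^{-α}` the right-hand side is Niederreiter's `C · P_α(z, n)`.) -/
theorem norm_latticeRule_sub_integral_le_of_le (n : ℕ) [NeZero n] (z : d → ℤ)
    {f : C(UnitAddTorus d, ℂ)} (hf : Summable (mFourierCoeff f)) {b : (d → ℤ) → ℝ} {B : ℝ}
    (hb : ∀ h : d → ℤ, h ≠ 0 → h ∈ dualLattice n z → ‖mFourierCoeff f h‖ ≤ b h)
    (hB : HasSum (fun h : ((dualLattice n z : Set (d → ℤ)) \ {0} : Set (d → ℤ)) => b h) B) :
    ‖latticeRule n z f - ∫ x, f x‖ ≤ B :=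
  (hasSum_latticeRule_sub_integral n z hf).norm_le_of_bounded hB fun h =>
    hb h (by simpa using h.2.2) h.2.1

/-! ### Cranley–Patterson random shifts -/

/-- **Random shifts are unbiased** [cite: Lemieux2009, Prop. 6.1] (§6.2.1, the
"Cranley–Patterson rotation" of Cranley–Patterson 1976): for every nonempty finite node family `P`
and every integrable `f` on `𝕋ᵈ`, the shifted equal-weight rule `Δ ↦ Q_{P+Δ}(f)` has mean `∫ f`
over a uniformly distributed shift `Δ ∈ 𝕋ᵈ` (each shifted node is uniformly distributed:
translation invariance of Haar measure). -/
theorem integral_qmcAverage_add_eq {ι : Type*} [Fintype ι] [Nonempty ι] (P : ι → UnitAddTorus d)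
    {E : Type*} [NormedAddCommGroup E] [NormedSpace ℝ E] {f : UnitAddTorus d → E}
    (hf : Integrable f) :
    ∫ Δ, qmcAverage (fun i => P i + Δ) f = ∫ x, f x := by
  simp only [qmcAverage]
  rw [integral_smul, integral_finsetSum _ (fun i _ => hf.comp_add_left (P i))]
  simp_rw [integral_add_left_eq_self]
  rw [sum_const, card_univ, ← Nat.cast_smul_eq_nsmul ℝ, smul_smul,
    inv_mul_cancel₀ (by exact_mod_cast Fintype.card_ne_zero), one_smul]

/-- **Randomly shifted lattice rules are unbiased** [cite: Lemieux2009, Prop. 6.1] (§6.2.1):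
`∫_{𝕋ᵈ} Q_{n,z}(f(· + Δ)) dΔ = ∫_{𝕋ᵈ} f` for integrable `f`. -/
theorem integral_latticeRule_add_eq (n : ℕ) [NeZero n] (z : d → ℤ)
    {E : Type*} [NormedAddCommGroup E] [NormedSpace ℝ E] {f : UnitAddTorus d → E}
    (hf : Integrable f) :
    ∫ Δ, latticeRule n z (fun x => f (x + Δ)) = ∫ x, f x :=
  integral_qmcAverage_add_eq (latticeNode n z) hf

/-! ### Fourier coefficients of the shift map and the shift variance (Parseval) -/

/-- `∫_{𝕋ᵈ}` of a character: `∫ e_m = 1` if `m = 0` and `= 0` otherwise (orthonormality of the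
`e_m`, from Mathlib's `UnitAddTorus.orthonormal_mFourier`). [folklore] -/
private theorem integral_mFourier (m : d → ℤ) :
    ∫ x, mFourier m x = if m = 0 then (1 : ℂ) else 0 := by
  have H := orthonormal_iff_ite.mp (orthonormal_mFourier (d := d)) 0 m
  simp only [ContinuousMap.inner_toLp, mFourier_zero, ContinuousMap.one_apply, map_one,
    mul_one] at H
  rw [H]
  by_cases hm : m = 0
  · simp [hm]
  · simp [hm, Ne.symm hm]

/-- The characters are multiplicative in the argument: `e_m(x + y) = e_m(x) e_m(y)`. [folklore] -/
private theorem mFourier_apply_add (m : d → ℤ) (x y : UnitAddTorus d) :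
    mFourier m (x + y) = mFourier m x * mFourier m y := by
  simp only [mFourier, ContinuousMap.coe_mk, Pi.add_apply, fourier_apply, zsmul_add,
    AddCircle.toCircle_add, Circle.coe_mul, prod_mul_distrib]

/-- `e_m(-x) = e_{-m}(x)`. [folklore] -/
private theorem mFourier_apply_neg (m : d → ℤ) (x : UnitAddTorus d) :
    mFourier m (-x) = mFourier (-m) x := by
  simp only [mFourier, ContinuousMap.coe_mk, Pi.neg_apply, fourier_apply, zsmul_neg, neg_zsmul]

/-- **Fourier coefficients of a translate**: `(f(c + ·))^(h) = e_h(c) · f̂(h)` (translation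
invariance of Haar measure on `𝕋ᵈ`). [folklore] -/
private theorem mFourierCoeff_comp_add_left {E : Type*} [NormedAddCommGroup E]
    [NormedSpace ℂ E] (f : UnitAddTorus d → E) (c : UnitAddTorus d) (h : d → ℤ) :
    mFourierCoeff (fun x => f (c + x)) h = mFourier h c • mFourierCoeff f h := by
  have H := integral_add_left_eq_self (μ := (volume : Measure (UnitAddTorus d)))
    (fun u => mFourier (-h) (u - c) • f u) c
  simp only [add_sub_cancel_left] at H
  simp only [mFourierCoeff]
  rw [H]
  have h1 : ∀ u, mFourier (-h) (u - c) = mFourier h c * mFourier (-h) u := by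
    intro u
    rw [sub_eq_add_neg, mFourier_apply_add, mFourier_apply_neg, neg_neg, mul_comm]
  simp_rw [h1, mul_smul, integral_smul]

/-- `‖e_m(x)‖ ≤ 1` (in fact `= 1`). [folklore] -/
private theorem norm_mFourier_apply_le (m : d → ℤ) (x : UnitAddTorus d) :
    ‖mFourier m x‖ ≤ 1 :=
  ((mFourier m).norm_coe_le_norm x).trans_eq mFourier_norm

/-- `e_{-h} • g` is integrable whenever `g` is. [folklore] -/
private theorem integrable_mFourier_smul {E : Type*} [NormedAddCommGroup E]
    [NormedSpace ℂ E] {g : UnitAddTorus d → E} (hg : Integrable g) (m : d → ℤ) :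
    Integrable (fun t => mFourier m t • g t) :=
  hg.bdd_smul 1 (mFourier m).continuous.aestronglyMeasurable
    (ae_of_all _ fun t => norm_mFourier_apply_le m t)

/-- The equal-weight rule integrates constants exactly: `Q_P(e_0) = Q_P(1) = 1` (nonempty `P`).
[folklore] -/
private theorem qmcAverage_mFourier_zero {ι : Type*} [Fintype ι] [Nonempty ι]
    (P : ι → UnitAddTorus d) : qmcAverage P (mFourier 0) = (1 : ℂ) := by
  have hc : (Fintype.card ι : ℂ) ≠ 0 := by exact_mod_cast Fintype.card_ne_zero
  simp only [qmcAverage, mFourier_zero, ContinuousMap.one_apply, sum_const, card_univ,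
    nsmul_eq_mul, mul_one, Complex.real_smul]
  push_cast
  field_simp

/-- **Fourier coefficients of the shift map** `g(Δ) = Q_{P+Δ}(f)` of an integrable `f`:
`ĝ(h) = Q_P(e_h) · f̂(h)`. [folklore] -/
private theorem mFourierCoeff_qmcAverage_add {ι : Type*} [Fintype ι] (P : ι → UnitAddTorus d)
    {f : UnitAddTorus d → ℂ} (hf : Integrable f) (h : d → ℤ) :
    mFourierCoeff (fun Δ => qmcAverage (fun i => P i + Δ) f) h =
      qmcAverage P (mFourier h) * mFourierCoeff f h := by
  have hint : ∀ i, Integrable (fun t => mFourier (-h) t • f (P i + t)) := fun i =>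
    integrable_mFourier_smul (hf.comp_add_left (P i)) (-h)
  calc mFourierCoeff (fun Δ => qmcAverage (fun i => P i + Δ) f) h
      = ∫ t, (Fintype.card ι : ℝ)⁻¹ • ∑ i, mFourier (-h) t • f (P i + t) := by
        simp only [mFourierCoeff, qmcAverage, smul_sum, smul_comm (mFourier (-h) _)]
    _ = (Fintype.card ι : ℝ)⁻¹ • ∑ i, mFourierCoeff (fun x => f (P i + x)) h := by
        rw [integral_smul, integral_finsetSum _ (fun i _ => hint i)]
        rfl
    _ = qmcAverage P (mFourier h) * mFourierCoeff f h := by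
        simp only [mFourierCoeff_comp_add_left, qmcAverage, smul_eq_mul, ← sum_mul,
          Complex.real_smul, mul_assoc]

/-- Parseval for a concrete square-integrable function on `𝕋ᵈ` (Mathlib's
`UnitAddTorus.hasSum_sq_mFourierCoeff` transported along `MemLp.toLp`). [folklore] -/
private theorem hasSum_sq_mFourierCoeff_of_memLp {G : UnitAddTorus d → ℂ}
    (hG : MemLp G 2 volume) :
    HasSum (fun h => ‖mFourierCoeff G h‖ ^ 2) (∫ t, ‖G t‖ ^ 2) := by
  have H := hasSum_sq_mFourierCoeff (hG.toLp G)
  have h1 : ∀ h, mFourierCoeff (hG.toLp G) h = mFourierCoeff G h := fun h =>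
    integral_congr_ae (hG.coeFn_toLp.mono fun t ht => by simp only [ht])
  have h2 : ∫ t, ‖hG.toLp G t‖ ^ 2 = ∫ t, ‖G t‖ ^ 2 :=
    integral_congr_ae (hG.coeFn_toLp.mono fun t ht => by simp only [ht])
  simpa only [h1, h2] using H

/-- The shift map `Δ ↦ Q_{P+Δ}(f)` of a square-integrable `f` is square-integrable. [folklore] -/
private theorem memLp_qmcAverage_add {ι : Type*} [Fintype ι] (P : ι → UnitAddTorus d)
    {f : UnitAddTorus d → ℂ} (hf : MemLp f 2 volume) :
    MemLp (fun Δ => qmcAverage (fun i => P i + Δ) f) 2 volume := by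
  have H : ∀ i ∈ (univ : Finset ι), MemLp (fun Δ => f (P i + Δ)) 2 volume := fun i _ =>
    hf.comp_measurePreserving (measurePreserving_add_left volume (P i))
  exact (memLp_finsetSum univ H).const_smul _

/-- **Variance of a randomly shifted equal-weight rule** (Parseval): for square-integrable `f` and a
nonempty finite node family `P`,
`∫_{𝕋ᵈ} ‖Q_{P+Δ}(f) - ∫ f‖² dΔ = Σ_{h ≠ 0} |Q_P(e_h)|² |f̂(h)|²`, written as a sum over all
`h ∈ ℤᵈ` with the `h = 0` term removed. [folklore] -/
private theorem hasSum_integral_norm_sq_qmcAverage_sub {ι : Type*} [Fintype ι] [Nonempty ι]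
    (P : ι → UnitAddTorus d) {f : UnitAddTorus d → ℂ} (hf : MemLp f 2 volume) :
    HasSum (fun h : d → ℤ =>
        if h = 0 then 0 else ‖qmcAverage P (mFourier h)‖ ^ 2 * ‖mFourierCoeff f h‖ ^ 2)
      (∫ Δ, ‖qmcAverage (fun i => P i + Δ) f - ∫ x, f x‖ ^ 2) := by
  classical
  set I : ℂ := ∫ x, f x with hI
  set g : UnitAddTorus d → ℂ := fun Δ => qmcAverage (fun i => P i + Δ) f with hg
  have hgm : MemLp g 2 volume := memLp_qmcAverage_add P hf
  have hGm : MemLp (fun Δ => g Δ - I) 2 volume := hgm.sub (memLp_const I)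
  have hfi : Integrable f := hf.integrable one_le_two
  have hgi : Integrable g := hgm.integrable one_le_two
  -- Fourier coefficients of `g - I`
  have hcoef : ∀ h : d → ℤ, mFourierCoeff (fun Δ => g Δ - I) h =
      if h = 0 then 0 else qmcAverage P (mFourier h) * mFourierCoeff f h := by
    intro h
    have e1 : mFourierCoeff (fun Δ => g Δ - I) h =
        mFourierCoeff g h - mFourierCoeff (fun _ => I) h := by
      simp only [mFourierCoeff, smul_sub]
      exact integral_sub (integrable_mFourier_smul hgi (-h))
        (integrable_mFourier_smul (integrable_const I) (-h))
    have e2 : mFourierCoeff (fun _ : UnitAddTorus d => I) h = if h = 0 then I else 0 := by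
      simp only [mFourierCoeff, integral_smul_const, integral_mFourier, neg_eq_zero]
      split_ifs <;> simp
    rw [e1, e2, hg, mFourierCoeff_qmcAverage_add P hfi h]
    split_ifs with h0
    · subst h0
      rw [qmcAverage_mFourier_zero, one_mul, mFourierCoeff_zero, hI, sub_self]
    · rw [sub_zero]
  have H := hasSum_sq_mFourierCoeff_of_memLp hGm
  refine H.congr_fun fun h => ?_
  rw [hcoef h]
  split_ifs <;> simp [mul_pow]

/-- **Variance of a randomly shifted lattice rule** [cite: Lemieux2009, Prop. 6.2]
(eq. (6.4); due to L'Ecuyer–Lemieux 2000): for square-integrable `f` on `𝕋ᵈ`,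
`∫_{𝕋ᵈ} ‖Q_{n,z}(f(· + Δ)) - ∫ f‖² dΔ = Σ_{0 ≠ h ∈ L⊥} |f̂(h)|²`. Together with
`integral_latticeRule_add_eq` (mean `∫ f`) this is the variance of the randomly-shifted
lattice-rule estimator. -/
theorem hasSum_integral_norm_sq_latticeRule_sub (n : ℕ) [NeZero n] (z : d → ℤ)
    {f : UnitAddTorus d → ℂ} (hf : MemLp f 2 volume) :
    HasSum (fun h : ((dualLattice n z : Set (d → ℤ)) \ {0} : Set (d → ℤ)) =>
        ‖mFourierCoeff f h‖ ^ 2)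
      (∫ Δ, ‖latticeRule n z (fun x => f (x + Δ)) - ∫ x, f x‖ ^ 2) := by
  classical
  refine (hasSum_subtype_iff_indicator (f := fun h : d → ℤ => ‖mFourierCoeff f h‖ ^ 2)
    (s := ((dualLattice n z : Set (d → ℤ)) \ {0} : Set (d → ℤ)))).mpr
    ((hasSum_integral_norm_sq_qmcAverage_sub (latticeNode n z) hf).congr_fun fun h => ?_)
  change _ = ite _ _ (‖latticeRule n z (mFourier h)‖ ^ 2 * _)
  rw [latticeRule_mFourier]
  simp only [Set.indicator_apply, Set.mem_sdiff, Set.mem_singleton_iff, SetLike.mem_coe]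
  by_cases h0 : h = 0 <;> by_cases hL : h ∈ dualLattice n z <;> simp [h0, hL]

/-- The shift variance of a lattice rule in `tsum` form:
`∫ ‖Q_{n,z}(f(· + Δ)) - ∫ f‖² dΔ = Σ'_{0 ≠ h ∈ L⊥} ‖f̂(h)‖²`. [cite: Lemieux2009, Prop. 6.2] -/
theorem integral_norm_sq_latticeRule_sub_eq_tsum (n : ℕ) [NeZero n] (z : d → ℤ)
    {f : UnitAddTorus d → ℂ} (hf : MemLp f 2 volume) :
    ∫ Δ, ‖latticeRule n z (fun x => f (x + Δ)) - ∫ x, f x‖ ^ 2 =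
      ∑' h : ((dualLattice n z : Set (d → ℤ)) \ {0} : Set (d → ℤ)), ‖mFourierCoeff f h‖ ^ 2 :=
  (hasSum_integral_norm_sq_latticeRule_sub n z hf).tsum_eq.symm

end Literature.Analysis.Quadrature

end
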